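import Literature.Dynamics.NBody.AlbouyKaloshin2012Roberts
import HarnessLib

/-!
# Albouy–Kaloshin 2012, system (4) on `E32 = {m₁ = m₂, m₃ = m₄}`: the reflection-symmetric slices

Topic `Literature/Dynamics/NBody`. System (4) / Definition 2 of [AlbouyKaloshin2012] (p. 540) is
typed in `AlbouyKaloshin2012Roberts.lean` as `IsRealNormalizedCC m q δ`. For masses on the
exceptional component `E32` (relation (32) p. 576, diagram 6), normalised as `(1, 1, b, b, c)`, the
`pub-smale6` cell probes the solution set of (4) through its REFLECTION-SYMMETRIC SLICES
(`run/shared/lean/pub/pub-smale6/certs/sym_e32/`, `certs/modgb/`):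

* `T12`: bodies 1, 2 (masses 1, 1) mirror images of each other, bodies 3, 4, 5 on the mirror axis;
* `T1234`: bodies 1 ↔ 2 and 3 ↔ 4 swapped by the mirror, body 5 on the axis.

(The third type, pair {3,4} mirror-symmetric with 1, 2, 5 on the axis, is `T12` for the renumbered
and rescaled masses `(1, 1, 1/b, 1/b, c/b)`.) Taking the mirror to be the `y`-axis makes the paper's
normalisation `y₁ = y₂` automatic, so each slice is literally a coordinate subspace of the unknowns
of (4). This file kernel-checks that the 12 (resp. 11) polynomial equations used by the cell ARE
system (4) restricted to that subspace — in both directions: a point of the subspace solves (4) iff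
the slice equations vanish. The slice polynomials below are, after the renaming
`(s,t,y₃,y₄,y₅) ↦ (y1,x1,x3,x4,x5)` (a rotation by 90°), exactly `T12`/`T1234` of
`certs/sym_e32` (gen 1, `code/sym_e32.py`) and of `code/modgb/systems.py` (gen 2), whose mod-p
Gröbner bases are reported in `certs/modgb/README.md`.

What is NOT claimed: nothing about finiteness at any other mass point. At `(b, c) = (1, 1/4)` the
slice `T12` contains the modified Roberts continuum (p. 543; `AlbouyKaloshin2012Roberts.lean` after
doubling the masses, which rescales positions by `2^{1/3}`): `t12Slice_roberts` checks all twelve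
equations on that explicit family and `t12Slice_one_quarter_infinite` records that `T12(1, 1/4)`
has infinitely many real solutions — the calibration instance at which the cell's Gröbner engines
must (and do) report positive dimension.
-/

namespace Literature.Dynamics.NBody

/-- The `E32` mass vector `(1, 1, b, b, c)` (relation (32): `m₁ = m₂`, `m₃ = m₄`). [folklore] -/
def e32Masses (b c : ℝ) : Fin 5 → ℝ := ![1, 1, b, b, c]

/-- `T12` ansatz: bodies 1, 2 at `(∓s, t)` (mirror images in the `y`-axis, equal ordinates — the
paper's normalisation), bodies 3, 4, 5 on the axis at heights `y₃, y₄, y₅`. [folklore] -/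
def t12Q (s t y₃ y₄ y₅ : ℝ) : Fin 5 → ℝ × ℝ := ![(-s, t), (s, t), (0, y₃), (0, y₄), (0, y₅)]

/-- `T12` inverse distances: `u = δ₁₂`, `p_k = δ₁ₖ = δ₂ₖ` (k = 3,4,5, forced by the mirror),
`d₃₄, d₃₅, d₄₅`. [folklore] -/
def t12Delta (u p₃ p₄ p₅ d₃₄ d₃₅ d₄₅ : ℝ) : Fin 5 → Fin 5 → ℝ :=
  ![![0, u, p₃, p₄, p₅],
    ![u, 0, p₃, p₄, p₅],
    ![p₃, p₃, 0, d₃₄, d₃₅],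
    ![p₄, p₄, d₃₄, 0, d₄₅],
    ![p₅, p₅, d₃₅, d₄₅, 0]]

/-- The twelve `T12` slice equations of the cell (`certs/sym_e32`, `code/modgb/systems.py::slice_T12`
with `x1 ↦ t, y1 ↦ s, x3,x4,x5 ↦ y₃,y₄,y₅`): `X1, Y1, X3, X4, X5` and the seven inverse-distance
relations `D12, D13, D14, D15, D34, D35, D45`. [folklore] -/
def T12Slice (b c s t y₃ y₄ y₅ u p₃ p₄ p₅ d₃₄ d₃₅ d₄₅ : ℝ) : Prop :=
  t - (b * p₃ ^ 3 * (t - y₃) + b * p₄ ^ 3 * (t - y₄) + c * p₅ ^ 3 * (t - y₅)) = 0 ∧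
  s - (2 * u ^ 3 * s + b * p₃ ^ 3 * s + b * p₄ ^ 3 * s + c * p₅ ^ 3 * s) = 0 ∧
  y₃ - (2 * p₃ ^ 3 * (y₃ - t) + b * d₃₄ ^ 3 * (y₃ - y₄) + c * d₃₅ ^ 3 * (y₃ - y₅)) = 0 ∧
  y₄ - (2 * p₄ ^ 3 * (y₄ - t) + b * d₃₄ ^ 3 * (y₄ - y₃) + c * d₄₅ ^ 3 * (y₄ - y₅)) = 0 ∧
  y₅ - (2 * p₅ ^ 3 * (y₅ - t) + b * d₃₅ ^ 3 * (y₅ - y₃) + b * d₄₅ ^ 3 * (y₅ - y₄)) = 0 ∧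
  u ^ 2 * (4 * s ^ 2) - 1 = 0 ∧
  p₃ ^ 2 * ((y₃ - t) ^ 2 + s ^ 2) - 1 = 0 ∧
  p₄ ^ 2 * ((y₄ - t) ^ 2 + s ^ 2) - 1 = 0 ∧
  p₅ ^ 2 * ((y₅ - t) ^ 2 + s ^ 2) - 1 = 0 ∧
  d₃₄ ^ 2 * (y₄ - y₃) ^ 2 - 1 = 0 ∧
  d₃₅ ^ 2 * (y₅ - y₃) ^ 2 - 1 = 0 ∧
  d₄₅ ^ 2 * (y₅ - y₄) ^ 2 - 1 = 0

/-- **`T12` is system (4) on its subspace.** For every real parameter choice, the mirror-symmetric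
pair (positions `t12Q`, inverse distances `t12Delta`) is a real normalized central configuration
of the masses `(1,1,b,b,c)` in the sense of Definition 2 / system (4) of [AlbouyKaloshin2012]
(p. 540) if and only if the twelve slice equations `T12Slice` hold. [cite: AlbouyKaloshin2012, Definition 2 and system (4), p. 540] -/
theorem isRealNormalizedCC_t12_iff (b c s t y₃ y₄ y₅ u p₃ p₄ p₅ d₃₄ d₃₅ d₄₅ : ℝ) :
    IsRealNormalizedCC (e32Masses b c) (t12Q s t y₃ y₄ y₅) (t12Delta u p₃ p₄ p₅ d₃₄ d₃₅ d₄₅) ↔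
      T12Slice b c s t y₃ y₄ y₅ u p₃ p₄ p₅ d₃₄ d₃₅ d₄₅ := by
  constructor
  · rintro ⟨-, hD, hC, -⟩
    have e1 := congrArg Prod.snd (hC 0)
    have e2 := congrArg Prod.fst (hC 0)
    have e3 := congrArg Prod.snd (hC 2)
    have e4 := congrArg Prod.snd (hC 3)
    have e5 := congrArg Prod.snd (hC 4)
    have d12 := hD 0 1 (by decide)
    have d13 := hD 0 2 (by decide)
    have d14 := hD 0 3 (by decide)
    have d15 := hD 0 4 (by decide)
    have d34 := hD 2 3 (by decide)
    have d35 := hD 2 4 (by decide)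
    have d45 := hD 3 4 (by decide)
    simp [e32Masses, t12Q, t12Delta, sqDist, Fin.sum_univ_five] at e1 e2 e3 e4 e5 d12 d13 d14 d15 d34 d35 d45
    refine ⟨?_, ?_, ?_, ?_, ?_, ?_, ?_, ?_, ?_, ?_, ?_, ?_⟩ <;>
    first
      | linear_combination e1 | linear_combination (-1 : ℝ) * e1
      | linear_combination e2 | linear_combination (-1 : ℝ) * e2
      | linear_combination e3 | linear_combination (-1 : ℝ) * e3
      | linear_combination e4 | linear_combination (-1 : ℝ) * e4
      | linear_combination e5 | linear_combination (-1 : ℝ) * e5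
      | linear_combination d12 | linear_combination d13 | linear_combination d14
      | linear_combination d15 | linear_combination d34 | linear_combination d35
      | linear_combination d45
  · rintro ⟨hX1, hY1, hX3, hX4, hX5, hD12, hD13, hD14, hD15, hD34, hD35, hD45⟩
    refine ⟨?_, ?_, ?_, ?_⟩
    · intro k l
      fin_cases k <;> fin_cases l <;> simp [t12Delta]
    · intro k l hkl
      fin_cases k <;> fin_cases l <;> simp [t12Delta, t12Q, sqDist] at hkl ⊢ <;>
      first
        | linear_combination hD12 | linear_combination hD13 | linear_combination hD14
        | linear_combination hD15 | linear_combination hD34 | linear_combination hD35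
        | linear_combination hD45
    · intro k
      fin_cases k <;>
        simp [e32Masses, t12Delta, t12Q, Fin.sum_univ_five, Prod.ext_iff] <;>
        (try constructor) <;>
        first
          | linear_combination hX1 | linear_combination (-1 : ℝ) * hX1
          | linear_combination hY1 | linear_combination (-1 : ℝ) * hY1
          | linear_combination hX3 | linear_combination (-1 : ℝ) * hX3
          | linear_combination hX4 | linear_combination (-1 : ℝ) * hX4
          | linear_combination hX5
    · intro h0 h1
      simp [t12Q]

/-- `T1234` ansatz: bodies 1, 2 at `(∓a₁, t₁)`, bodies 3, 4 at `(∓a₃, t₃)` (both pairs mirror images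
in the `y`-axis; `y₁ = y₂` automatic), body 5 on the axis at height `t₅`. [folklore] -/
def t1234Q (a₁ t₁ a₃ t₃ t₅ : ℝ) : Fin 5 → ℝ × ℝ :=
  ![(-a₁, t₁), (a₁, t₁), (-a₃, t₃), (a₃, t₃), (0, t₅)]

/-- `T1234` inverse distances: `u = δ₁₂`, `v = δ₃₄`, `p = δ₁₃ = δ₂₄`, `r = δ₁₄ = δ₂₃`,
`e = δ₁₅ = δ₂₅`, `f = δ₃₅ = δ₄₅` (pairings forced by the mirror). [folklore] -/
def t1234Delta (u v p r e f : ℝ) : Fin 5 → Fin 5 → ℝ :=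
  ![![0, u, p, r, e],
    ![u, 0, r, p, e],
    ![p, r, 0, v, f],
    ![r, p, v, 0, f],
    ![e, e, f, f, 0]]

/-- The eleven `T1234` slice equations of the cell (`certs/sym_e32`, `code/modgb/systems.py::slice_T1234`
with `x1 ↦ t₁, y1 ↦ a₁, x3 ↦ t₃, y3 ↦ a₃, x5 ↦ t₅` and the inverse distance called `s` there ↦ `r`):
`X1, Y1, X3, Y3, X5, D12, D34, D13, D14, D15, D35`. [folklore] -/
def T1234Slice (b c a₁ t₁ a₃ t₃ t₅ u v p r e f : ℝ) : Prop :=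
  t₁ - (b * p ^ 3 * (t₁ - t₃) + b * r ^ 3 * (t₁ - t₃) + c * e ^ 3 * (t₁ - t₅)) = 0 ∧
  a₁ - (2 * u ^ 3 * a₁ + b * p ^ 3 * (a₁ - a₃) + b * r ^ 3 * (a₁ + a₃) + c * e ^ 3 * a₁) = 0 ∧
  t₃ - (p ^ 3 * (t₃ - t₁) + r ^ 3 * (t₃ - t₁) + c * f ^ 3 * (t₃ - t₅)) = 0 ∧
  a₃ - (p ^ 3 * (a₃ - a₁) + r ^ 3 * (a₃ + a₁) + 2 * b * v ^ 3 * a₃ + c * f ^ 3 * a₃) = 0 ∧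
  t₅ - (2 * e ^ 3 * (t₅ - t₁) + 2 * b * f ^ 3 * (t₅ - t₃)) = 0 ∧
  u ^ 2 * (4 * a₁ ^ 2) - 1 = 0 ∧
  v ^ 2 * (4 * a₃ ^ 2) - 1 = 0 ∧
  p ^ 2 * ((t₃ - t₁) ^ 2 + (a₃ - a₁) ^ 2) - 1 = 0 ∧
  r ^ 2 * ((t₃ - t₁) ^ 2 + (a₃ + a₁) ^ 2) - 1 = 0 ∧
  e ^ 2 * ((t₅ - t₁) ^ 2 + a₁ ^ 2) - 1 = 0 ∧
  f ^ 2 * ((t₅ - t₃) ^ 2 + a₃ ^ 2) - 1 = 0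

/-- **`T1234` is system (4) on its subspace.** For every real parameter choice, the doubly
mirror-symmetric pair (`t1234Q`, `t1234Delta`) is a real normalized central configuration of the masses
`(1,1,b,b,c)` (Definition 2 / system (4) of [AlbouyKaloshin2012], p. 540) if and only if the eleven
slice equations `T1234Slice` hold. [cite: AlbouyKaloshin2012, Definition 2 and system (4), p. 540] -/
theorem isRealNormalizedCC_t1234_iff (b c a₁ t₁ a₃ t₃ t₅ u v p r e f : ℝ) :
    IsRealNormalizedCC (e32Masses b c) (t1234Q a₁ t₁ a₃ t₃ t₅) (t1234Delta u v p r e f) ↔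
      T1234Slice b c a₁ t₁ a₃ t₃ t₅ u v p r e f := by
  constructor
  · rintro ⟨-, hD, hC, -⟩
    have e1 := congrArg Prod.snd (hC 0)
    have e2 := congrArg Prod.fst (hC 0)
    have e3 := congrArg Prod.snd (hC 2)
    have e4 := congrArg Prod.fst (hC 2)
    have e5 := congrArg Prod.snd (hC 4)
    have d12 := hD 0 1 (by decide)
    have d34 := hD 2 3 (by decide)
    have d13 := hD 0 2 (by decide)
    have d14 := hD 0 3 (by decide)
    have d15 := hD 0 4 (by decide)
    have d35 := hD 2 4 (by decide)
    simp [e32Masses, t1234Q, t1234Delta, sqDist, Fin.sum_univ_five] at e1 e2 e3 e4 e5 d12 d34 d13 d14 d15 d35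
    refine ⟨?_, ?_, ?_, ?_, ?_, ?_, ?_, ?_, ?_, ?_, ?_⟩ <;>
    first
      | linear_combination e1 | linear_combination (-1 : ℝ) * e1
      | linear_combination e2 | linear_combination (-1 : ℝ) * e2
      | linear_combination e3 | linear_combination (-1 : ℝ) * e3
      | linear_combination e4 | linear_combination (-1 : ℝ) * e4
      | linear_combination e5 | linear_combination (-1 : ℝ) * e5
      | linear_combination d12 | linear_combination d34 | linear_combination d13
      | linear_combination d14 | linear_combination d15 | linear_combination d35
  · rintro ⟨hX1, hY1, hX3, hY3, hX5, hD12, hD34, hD13, hD14, hD15, hD35⟩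
    refine ⟨?_, ?_, ?_, ?_⟩
    · intro k l
      fin_cases k <;> fin_cases l <;> simp [t1234Delta]
    · intro k l hkl
      fin_cases k <;> fin_cases l <;> simp [t1234Delta, t1234Q, sqDist] at hkl ⊢ <;>
      first
        | linear_combination hD12 | linear_combination hD34 | linear_combination hD13
        | linear_combination hD14 | linear_combination hD15 | linear_combination hD35
    · intro k
      fin_cases k <;>
        simp [e32Masses, t1234Delta, t1234Q, Fin.sum_univ_five, Prod.ext_iff] <;>
        (try constructor) <;>
        first
          | linear_combination hX1 | linear_combination (-1 : ℝ) * hX1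
          | linear_combination hY1 | linear_combination (-1 : ℝ) * hY1
          | linear_combination hX3 | linear_combination (-1 : ℝ) * hX3
          | linear_combination hY3 | linear_combination (-1 : ℝ) * hY3
          | linear_combination hX5
    · intro h0 h1
      simp [t1234Q]


/-- The cube root of two. Doubling all masses in system (4) rescales positions by `2^{1/3}`
(and inverse distances by `2^{-1/3}`); it carries the modified Roberts continuum of
`AlbouyKaloshin2012Roberts.lean` (masses `(1/2,1/2,1/2,1/2,1/8)`) to the `E32` normalisation
`(1,1,1,1,1/4)`, i.e. `(b, c) = (1, 1/4)`. [folklore] -/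
noncomputable def cbrtTwo : ℝ := (2 : ℝ) ^ ((3 : ℕ) : ℝ)⁻¹

/-- `cbrtTwo ^ 3 = 2`. [folklore] -/
theorem cbrtTwo_pow_three : cbrtTwo ^ 3 = 2 :=
  Real.rpow_inv_natCast_pow (by norm_num) (by norm_num)

/-- `0 < cbrtTwo`. [folklore] -/
theorem cbrtTwo_pos : 0 < cbrtTwo := Real.rpow_pos_of_pos (by norm_num) _

/-- **The modified Roberts continuum lies in the slice `T12` at `(b, c) = (1, 1/4)`.** For
`a ≠ 0`, `b' ≠ 0`, `a² + b'² = 1`: rhombus half-diagonals `2^{1/3}a` (bodies 1, 2, off the axis) and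
`2^{1/3}b'` (bodies 3, 4, on the axis), body 5 at the centre, `δ = +r⁻¹` on sides and diagonals and
`δ_k5 = −r_k5⁻¹` (p. 543). All twelve `T12` equations vanish (only `D13`, `D14` use `a² + b'² = 1`;
`Y1`, `X3`, `X4` use `(2^{1/3})³ = 2`). [cite: AlbouyKaloshin2012, p. 543 and Remark 8 p. 583] -/
theorem t12Slice_roberts (a b' : ℝ) (ha : a ≠ 0) (hb : b' ≠ 0) (hab : a ^ 2 + b' ^ 2 = 1) :
    T12Slice 1 (1 / 4) (cbrtTwo * a) 0 (cbrtTwo * b') (-(cbrtTwo * b')) 0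
      (1 / (2 * cbrtTwo * a)) (1 / cbrtTwo) (1 / cbrtTwo) (-1 / (cbrtTwo * a))
      (1 / (2 * cbrtTwo * b')) (-1 / (cbrtTwo * b')) (-1 / (cbrtTwo * b')) := by
  have hμ := cbrtTwo_pow_three
  have hμ0 := cbrtTwo_pos.ne'
  unfold T12Slice
  refine ⟨?_, ?_, ?_, ?_, ?_, ?_, ?_, ?_, ?_, ?_, ?_, ?_⟩ <;> field_simp <;>
    first
      | ring1
      | linear_combination (16 * a ^ 3) * hμ
      | linear_combination (32 * cbrtTwo * b' ^ 4) * hμ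
      | linear_combination (-32 * cbrtTwo * b' ^ 4) * hμ
      | linear_combination cbrtTwo ^ 2 * hab

/-- Hence the `T12` slice at `(b, c) = (1, 1/4)` has infinitely many real solutions (its projection
to the coordinate `s` already contains `2^{1/3} · (0, 1)`): the polynomial system `T12(1, 1/4)` is
positive-dimensional — the calibration point of `certs/sym_e32` and `certs/modgb`. [cite: AlbouyKaloshin2012, Remark 8 p. 583] -/
theorem t12Slice_one_quarter_infinite :
    Set.Infinite {s : ℝ | ∃ t y₃ y₄ y₅ u p₃ p₄ p₅ d₃₄ d₃₅ d₄₅ : ℝ,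
      T12Slice 1 (1 / 4) s t y₃ y₄ y₅ u p₃ p₄ p₅ d₃₄ d₃₅ d₄₅} := by
  have hinj : Set.InjOn (fun a : ℝ => cbrtTwo * a) (Set.Ioo (0 : ℝ) 1) := by
    intro a _ a' _ h
    have hμ0 := cbrtTwo_pos.ne'
    simpa [mul_right_inj' hμ0] using h
  have hsub : (fun a : ℝ => cbrtTwo * a) '' Set.Ioo (0 : ℝ) 1 ⊆
      {s : ℝ | ∃ t y₃ y₄ y₅ u p₃ p₄ p₅ d₃₄ d₃₅ d₄₅ : ℝ,
        T12Slice 1 (1 / 4) s t y₃ y₄ y₅ u p₃ p₄ p₅ d₃₄ d₃₅ d₄₅} := by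
    rintro _ ⟨a, ⟨ha0, ha1⟩, rfl⟩
    have hpos : 0 < 1 - a ^ 2 := by nlinarith
    set b' := Real.sqrt (1 - a ^ 2) with hb'
    have hb0 : b' ≠ 0 := (Real.sqrt_pos.mpr hpos).ne'
    have hab : a ^ 2 + b' ^ 2 = 1 := by
      rw [hb', Real.sq_sqrt hpos.le]; ring
    exact ⟨0, cbrtTwo * b', -(cbrtTwo * b'), 0, 1 / (2 * cbrtTwo * a), 1 / cbrtTwo, 1 / cbrtTwo,
      -1 / (cbrtTwo * a), 1 / (2 * cbrtTwo * b'), -1 / (cbrtTwo * b'), -1 / (cbrtTwo * b'),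
      t12Slice_roberts a b' ha0.ne' hb0 hab⟩
  exact ((Set.Ioo_infinite (by norm_num : (0 : ℝ) < 1)).image hinj).mono hsub

end Literature.Dynamics.NBody
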